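import Literature.RingTheory.HilbertSamuel.NormalConeFibreIdeal
import Literature.RingTheory.MvPolynomial.DirectrixPolynomialExtension
import Literature.RingTheory.HilbertSamuel.RegularCriterion
import HarnessLib

/-!
# Embedding dimension along a regular normally flat centre, `emb.dim A = μ(I) + dim A/I`, and the directrix under
# `k[X] ↪ k[X, T]` — LITERATURE HOIST of the fact-free kernel lemmas of the W4.2 file
# `…Corridor3Directrix214SharpCentreBase.lean` (res-type-001), needed by the Literature discharge of CJS Thm. 3.7

Topic: `Literature/RingTheory/HilbertSamuel`. The Summits-side T7b base file (cell res-hironaka, L W4.2) proves, fact-free,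
(i) **Nakayama for a minimal system of generators `g` of an ideal `I`** and its consequence «`J_D = normalConeIdeal g` has no
forms of degree `≤ 1`» (`eq_zero_of_mem_normalConeForms_of_le_one`); (ii) **`emb.dim A = μ(I) + dim A/I` whenever the
Hironaka–Grothendieck identity `J_z = J_D · k[Z]` holds** for `z = (g, y)` (`spanFinrank_maximalIdeal_eq_of_tangentConeIdeal_eq`
— then `J_z` has no linear forms and `H^{(0)}_A(1) = m + s`); (iii) **`e(J · k[X, T]) ≥ e(J) + #T`**
(`directrixDim_add_le_directrixDim_map_rename`, CJS Rem. 2.9 (c)). Literature files cannot import `Summits/…`, and the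
discharge of the named fact `CossartJannsenSaito2020_thm_3_7` (`DirectrixGenerizationProof.lean`) needs (ii)–(iii); this file is
their Literature home (proofs copied verbatim from the T7b base file, whose author is res-type-001; the Summits copies stay,
tree append-only). Everything PROVED; no named facts.

## References

* M. Herrmann, S. Ikeda, U. Orbanz, *Equimultiplicity and Blowing up* (1988), Cor. (21.11). [HerrmannIkedaOrbanz1988]
* V. Cossart, U. Jannsen, S. Saito, LNM 2270 (2020), Thm. 3.2 (2), Rem. 2.9 (c). [CossartJannsenSaito2020]
* H. Hironaka, J. Math. Kyoto Univ. 10 (1970), §2 p. 152–153. [Hironaka1970NumericalCharacters]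
-/

noncomputable section

open IsLocalRing MvPolynomial Module
open Literature.RingTheory.MvPolynomial

namespace Literature.RingTheory.HilbertSamuel

universe u v

/-! ## Forms of degree `≤ 1` -/

section LowDegree

variable {R : Type u} [CommRing R] {σ : Type v}

/-- A finsupp of degree `1` is a single variable. [folklore] -/
private theorem exists_eq_single_of_degree_eq_one (d : σ →₀ ℕ) (hd : d.degree = 1) : ∃ j, d = Finsupp.single j 1 := by
  classical
  have hne : d ≠ 0 := by
    intro h
    rw [h, map_zero] at hd
    exact zero_ne_one hd
  obtain ⟨j, hj⟩ := Finsupp.ne_iff.mp hne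
  have hle : d j ≤ 1 := hd ▸ Finsupp.le_degree j d
  have hdj : d j = 1 := by
    have : d j ≠ 0 := by simpa using hj
    omega
  refine ⟨j, ?_⟩
  have hsplit := Finsupp.single_add_erase j d
  have hdeg : (Finsupp.single j (d j)).degree + (d.erase j).degree = 1 := by
    rw [← map_add, hsplit, hd]
  rw [Finsupp.degree_single, hdj] at hdeg
  have herase : d.erase j = 0 := (Finsupp.degree_eq_zero_iff _).mp (by omega)
  rw [← hsplit, herase, add_zero, hdj]

/-- A form of degree `1` in finitely many variables is `Σ_j c_j X_j` with `c_j` its `X_j`-coefficients.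
[folklore] -/
private theorem eq_sum_C_mul_X_of_isHomogeneous_one {m : ℕ} {F : MvPolynomial (Fin m) R} (hF : F.IsHomogeneous 1) :
    F = ∑ j, C (coeff (Finsupp.single j 1) F) * X j := by
  classical
  refine MvPolynomial.ext _ _ fun d => ?_
  rw [coeff_sum]
  simp_rw [coeff_C_mul, coeff_X, mul_ite, mul_one, mul_zero]
  by_cases hd : ∃ j, d = Finsupp.single j 1
  · obtain ⟨j, rfl⟩ := hd
    rw [Finset.sum_eq_single j]
    · rw [if_pos rfl]
    · intro i _ hij
      rw [if_neg]
      intro h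
      exact hij (Finsupp.single_left_injective one_ne_zero h)
    · exact fun h => absurd (Finset.mem_univ j) h
  · rw [Finset.sum_eq_zero]
    · refine hF.coeff_eq_zero fun h1 => hd ?_
      obtain ⟨j, hj⟩ := exists_eq_single_of_degree_eq_one d h1
      exact ⟨j, hj⟩
    · intro i _
      rw [if_neg]
      exact fun h => hd ⟨i, h.symm⟩

end LowDegree

/-! ## Nakayama for a minimal system of generators of an ideal -/

section Minimal

variable {A : Type u} [CommRing A] [IsLocalRing A] {m : ℕ}

/-- **A linear relation among MINIMAL generators of an ideal has coefficients in `𝔪`**: if `g_1, …, g_m`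
generate `I` with `m = μ(I)` and `Σ r_i g_i ∈ 𝔪 I`, then every `r_i ∈ 𝔪` (otherwise `g_j` is superfluous modulo
`𝔪 I`, and by Nakayama `I` would be generated by `m − 1` elements). The case `I = 𝔪` is the tree's
`mem_maximalIdeal_of_sum_mul_mem_sq`, whose proof is followed. [folklore] -/
private theorem mem_maximalIdeal_of_sum_mul_mem_maximalIdeal_mul {g : Fin m → A}
    (hm : (Ideal.span (Set.range g)).spanFinrank = m) {r : Fin m → A}
    (h : ∑ i, r i * g i ∈ maximalIdeal A * Ideal.span (Set.range g)) (j : Fin m) :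
    r j ∈ maximalIdeal A := by
  classical
  set I : Ideal A := Ideal.span (Set.range g) with hI
  by_contra hrj
  have hu : IsUnit (r j) := (IsLocalRing.notMem_maximalIdeal.mp hrj)
  set s : Finset (Fin m) := Finset.univ.erase j with hs
  set N : Ideal A := Ideal.span (g '' (s : Set (Fin m))) with hN
  have hgN : ∀ i, i ≠ j → g i ∈ N := fun i hi =>
    Ideal.subset_span ⟨i, by simp [hs, hi], rfl⟩
  have hgj : g j ∈ N ⊔ maximalIdeal A • I := by
    have hsplit : r j * g j = ∑ i, r i * g i - ∑ i ∈ s, r i * g i := by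
      rw [hs, ← Finset.sum_erase_add _ _ (Finset.mem_univ j), add_sub_cancel_left]
    have hmem : r j * g j ∈ N ⊔ maximalIdeal A • I := by
      rw [hsplit]
      refine sub_mem ?_ ?_
      · refine Submodule.mem_sup_right ?_
        rw [Ideal.smul_eq_mul]
        exact h
      · exact Submodule.mem_sup_left (Ideal.sum_mem _ fun i hi =>
          Ideal.mul_mem_left _ _ (hgN i (Finset.ne_of_mem_erase hi)))
    have := Ideal.mul_mem_left _ (hu.unit⁻¹ : Aˣ).val hmem
    rwa [← mul_assoc, IsUnit.val_inv_mul, one_mul] at this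
  have hle : I ≤ N ⊔ maximalIdeal A • I := by
    refine Ideal.span_le.mpr ?_
    rintro _ ⟨i, rfl⟩
    by_cases hi : i = j
    · subst hi
      exact hgj
    · exact Submodule.mem_sup_left (hgN i hi)
  -- Nakayama: `I ⊆ N`
  have hfg : I.FG := ⟨(Finset.univ : Finset (Fin m)).image g, by rw [Finset.coe_image, Finset.coe_univ, Set.image_univ]⟩
  have hIN : I ≤ N :=
    Submodule.le_of_le_smul_of_le_jacobson_bot hfg (IsLocalRing.maximalIdeal_le_jacobson ⊥) hle
  have hNI : N ≤ I := Ideal.span_mono (Set.image_subset_range _ _)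
  have heq : I = N := le_antisymm hIN hNI
  have hrank : I.spanFinrank ≤ s.card := by
    rw [heq, hN]
    refine (Submodule.spanFinrank_span_le_ncard_of_finite (s.finite_toSet.image g)).trans ?_
    exact (Set.ncard_image_le s.finite_toSet).trans (by rw [Set.ncard_coe_finset])
  rw [hm, hs, Finset.card_erase_of_mem (Finset.mem_univ j), Finset.card_univ, Fintype.card_fin] at hrank
  have hpos : 0 < m := Fin.pos j
  omega

/-- **For MINIMAL generators `g` of `I`, the ideal `J_D` of the normal-cone fibre has no forms of degree
`≤ 1`**: a relation of degree `0` is a constant in `𝔪` (reduction `0`), and a relation `Σ c_i g_i ∈ 𝔪 I` of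
degree `1` has all `c_i ∈ 𝔪` (Nakayama) — the cone `C_{X,D,x}` spans `N_{D,x} = Spec Sym(I/𝔪I)`.
[cite: Hironaka1970NumericalCharacters, §2 p. 152–153 (C_{X,D,x} ⊂ Spec Sym(I/𝔪I))] -/
theorem eq_zero_of_mem_normalConeForms_of_le_one {g : Fin m → A}
    (hm : (Ideal.span (Set.range g)).spanFinrank = m) {d : ℕ} (hd : d ≤ 1)
    {f : MvPolynomial (Fin m) (ResidueField A)} (hf : f ∈ normalConeForms g d) : f = 0 := by
  obtain ⟨F, hF, hFg, rfl⟩ := hf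
  interval_cases d
  · -- degree 0: `F = C c`, `c ∈ 𝔪` (a form of degree `0` is a constant; the tree's
    -- `CampaignW31.eq_C_of_isHomogeneous_zero`, inlined to keep the import light)
    rw [(totalDegree_eq_zero_iff_eq_C.mp (Nat.le_zero.mp hF.totalDegree_le) : F = C (coeff 0 F))] at hFg ⊢
    rw [eval_C, pow_zero, mul_one] at hFg
    rw [map_C, (residue_eq_zero_iff _).mpr hFg, C_0]
  · -- degree 1: `F = Σ c_j X_j`, `Σ c_j g_j ∈ 𝔪 I`
    rw [eq_sum_C_mul_X_of_isHomogeneous_one hF] at hFg ⊢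
    have heval : eval g (∑ j, C (coeff (Finsupp.single j 1) F) * X j) =
        ∑ j, coeff (Finsupp.single j 1) F * g j := by
      rw [map_sum]
      refine Finset.sum_congr rfl fun j _ => ?_
      rw [map_mul, eval_C, eval_X]
    rw [heval, pow_one] at hFg
    rw [map_sum]
    refine Finset.sum_eq_zero fun j _ => ?_
    rw [map_mul, map_C, map_X,
      (residue_eq_zero_iff _).mpr (mem_maximalIdeal_of_sum_mul_mem_maximalIdeal_mul hm hFg j), C_0, zero_mul]

end Minimal

/-! ## No linear forms in `J_D · k[Z]`; the generating system `(g, y)` is minimal -/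

section NoLinearForms

variable {K : Type u} [Field K] {m n : ℕ}

/-- Closure of «all coefficients of degree `≤ 1` vanish» under the ideal generated by such elements.
[folklore] -/
private theorem coeff_eq_zero_of_mem_span {S : Set (MvPolynomial (Fin n) K)}
    (hS : ∀ s ∈ S, ∀ d : Fin n →₀ ℕ, d.degree ≤ 1 → coeff d s = 0)
    {f : MvPolynomial (Fin n) K} (hf : f ∈ Ideal.span S) (d : Fin n →₀ ℕ) (hd : d.degree ≤ 1) :
    coeff d f = 0 := by
  induction hf using Submodule.span_induction generalizing d with
  | mem s hs => exact hS s hs d hd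
  | zero => exact coeff_zero d
  | add p q _ _ hp hq => rw [coeff_add, hp d hd, hq d hd, add_zero]
  | smul a p _ hp =>
    rw [smul_eq_mul, coeff_mul]
    refine Finset.sum_eq_zero fun x hx => ?_
    have hx' : x.1 + x.2 = d := Finset.HasAntidiagonal.mem_antidiagonal.mp hx
    have hdeg : x.2.degree ≤ 1 := by
      have : x.1.degree + x.2.degree = d.degree := by rw [← map_add, hx']
      omega
    rw [hp x.2 hdeg, mul_zero]

/-- A form of degree `≥ 2` has no coefficients of degree `≤ 1`. [folklore] -/
private theorem coeff_eq_zero_of_isHomogeneous_of_two_le {f : MvPolynomial (Fin n) K} {e : ℕ} (hf : f.IsHomogeneous e)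
    (he : 2 ≤ e) (d : Fin n →₀ ℕ) (hd : d.degree ≤ 1) : coeff d f = 0 :=
  hf.coeff_eq_zero (by omega)

variable {A : Type u} [CommRing A] [IsLocalRing A]

/-- **`J_D · k[Z]` contains no form with a coefficient of degree `≤ 1`** when `g` is a minimal system of
generators of `I`: its generators are renamed forms of degree `≥ 2` (or `0`). [folklore] -/
private theorem coeff_eq_zero_of_mem_map_rename_normalConeIdeal {s : ℕ} {g : Fin m → A}
    (hm : (Ideal.span (Set.range g)).spanFinrank = m)
    {f : MvPolynomial (Fin (m + s)) (ResidueField A)}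
    (hf : f ∈ (normalConeIdeal g).map
      ((rename (Fin.castAdd s) : MvPolynomial (Fin m) (ResidueField A) →ₐ[ResidueField A]
        MvPolynomial (Fin (m + s)) (ResidueField A)) :
        MvPolynomial (Fin m) (ResidueField A) →+* MvPolynomial (Fin (m + s)) (ResidueField A)))
    (d : Fin (m + s) →₀ ℕ) (hd : d.degree ≤ 1) : coeff d f = 0 := by
  rw [normalConeIdeal, Ideal.map_span] at hf
  refine coeff_eq_zero_of_mem_span ?_ hf d hd
  rintro _ ⟨q, hq, rfl⟩ d' hd'
  obtain ⟨e, he⟩ := Set.mem_iUnion.mp hq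
  by_cases h2 : 2 ≤ e
  · exact coeff_eq_zero_of_isHomogeneous_of_two_le
      ((isHomogeneous_of_mem_normalConeForms g he).rename_isHomogeneous) h2 d' hd'
  · have hq0 : q = 0 := eq_zero_of_mem_normalConeForms_of_le_one hm (by omega) he
    rw [hq0]
    simp

/-- **The Hironaka–Grothendieck isomorphism forces `emb.dim A = μ(I) + dim A/I`**: if `J_z = J_D · k[Z]` for the
generating system `z = (g, y)` of `𝔪` with `g` minimal for `I`, then `z` is MINIMAL — `J_z` has no linear forms,
so `H^{(0)}_A(1) = dim k[Z]_1 = m + s` (degree-one piece of `(G(𝔭,R) ⊗ k)[T] ≅ G(𝔪,R)`: `𝔪/𝔪² ≅ I/𝔪I ⊕ k^s`).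
[cite: HerrmannIkedaOrbanz1988, Cor. (21.11) (degree-one piece)] [cite: CossartJannsenSaito2020, Thm. 3.2 (2)] -/
theorem spanFinrank_maximalIdeal_eq_of_tangentConeIdeal_eq [IsNoetherianRing A] {s : ℕ} {g : Fin m → A}
    {y : Fin s → A} (hm : (Ideal.span (Set.range g)).spanFinrank = m)
    (hz : Ideal.span (Set.range (Fin.append g y)) = maximalIdeal A)
    (hJ : tangentConeIdeal (Fin.append g y) hz = (normalConeIdeal g).map
      ((rename (Fin.castAdd s) : MvPolynomial (Fin m) (ResidueField A) →ₐ[ResidueField A]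
        MvPolynomial (Fin (m + s)) (ResidueField A)) :
        MvPolynomial (Fin m) (ResidueField A) →+* MvPolynomial (Fin (m + s)) (ResidueField A))) :
    (maximalIdeal A).spanFinrank = m + s := by
  have h1 := hilbertFun_one_eq_spanFinrank A
  have h2 := congrFun (hilbertFunQuot_tangentConeIdeal (Fin.append g y) hz) 1
  rw [← h1, ← h2, hilbertFunQuot, finrank_homogeneousSubmodule_one]
  have hbot : idealDegree (tangentConeIdeal (Fin.append g y) hz) 1 = ⊥ := by
    rw [eq_bot_iff]
    intro f hf
    rw [mem_idealDegree] at hf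
    rw [Submodule.mem_bot]
    refine MvPolynomial.ext _ _ fun d => ?_
    rw [coeff_zero]
    by_cases hd : d.degree = 1
    · rw [hJ] at hf
      exact coeff_eq_zero_of_mem_map_rename_normalConeIdeal hm hf.1 d hd.le
    · exact hf.2.coeff_eq_zero hd
  rw [hbot, finrank_bot, Nat.sub_zero]

end NoLinearForms

/-! ## Directrix numerics along `k[X] ↪ k[X, T]` -/

section Directrix

variable {K : Type u} [Field K] {m : ℕ}

/-- **`e(J · k[X,T]) ≥ e(J) + #T`**: extending the polynomial ring by `s` variables raises the directrix
dimension by at least `s` (`dim 𝒯(J · k[Z]) ≤ dim 𝒯(J)`, `finrank_directrixSpace_map_algHom_le`; in fact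
equality, CJS Rem. 2.9 (c), not needed). [cite: CossartJannsenSaito2020, Rem. 2.9 (c)] -/
theorem directrixDim_add_le_directrixDim_map_rename (s : ℕ) (J : Ideal (MvPolynomial (Fin m) K)) :
    directrixDim J + s ≤ directrixDim (J.map
      ((rename (Fin.castAdd s) : MvPolynomial (Fin m) K →ₐ[K] MvPolynomial (Fin (m + s)) K) :
        MvPolynomial (Fin m) K →+* MvPolynomial (Fin (m + s)) K)) := by
  have h := finrank_directrixSpace_map_algHom_le J
    (rename (Fin.castAdd s) : MvPolynomial (Fin m) K →ₐ[K] MvPolynomial (Fin (m + s)) K)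
    fun f hf => hf.rename_isHomogeneous
  have h1 := finrank_directrixSpace_add_directrixDim (I := J)
  have h2 := finrank_directrixSpace_add_directrixDim (I := J.map
      ((rename (Fin.castAdd s) : MvPolynomial (Fin m) K →ₐ[K] MvPolynomial (Fin (m + s)) K) :
        MvPolynomial (Fin m) K →+* MvPolynomial (Fin (m + s)) K))
  omega


end Directrix

end Literature.RingTheory.HilbertSamuel

end
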